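import Literature.Computability.Cryptography.RegevSamplerGeometry
import Literature.Computability.Cryptography.RegevSamplerAdmissible
import Literature.Computability.Cryptography.RegevSamplerAnswer
import HarnessLib

/-!
# Regev 2009, Lemma 3.14 in machine form: branch, coset index and good points of the rescaled grid

Topic `Computability/Cryptography` (family `pqc`), grouping namespace `Regev2009.SamplerGeom` (continued);
sequel of `RegevSamplerGeometry.lean` (the sampler's classical data in rescaled units: `LamT = L_t*/R`,
`bRT = t·e`, `DT = R|det B|/t`, reduction `yOfB`, coset index `sOfB`, good points `GoodT`) and of
`RegevSamplerArith.lean` / `RegevSamplerAdmissible.lean` / `RegevSamplerAnswer.lean` (the integer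
arithmetic of the classical stage on grid vectors `x̃`: branch `ytil`, residues `sNat`, `aVec`, the
admissibility of the query and the exactness of the recomposition on short lattice parts). Here the two
are identified on the rescaled grid points `t • gridPt I R x̃` (the points of the box, `boxPt_eq_smul_gridPt`),
as in the proof of Lemma 3.14 of Regev (J. ACM 56 (2009), art. 34: "compute `x mod P(L*)` … the natural
mapping between `L*/R ∩ P(L*)` and `ℤ_Rⁿ` … using the CVP oracle, we can recover `x`"):

* `yOfB_bRT_gridPt` — the branch of `t • gridPt x̃` is `t • gridPt (ytil x̃)`;
* `smul_gridPt_sub_yOfB` — its lattice part is `t • ⌊gridPt x̃⌋_e`;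
* **`sOfB_T_gridPt`**, `sOfB_T_gridPt_eq_sNat` — its coset index is `aVec x̃ mod R = sNat x̃`;
* `goodT_gridPt_iff` — it is good iff `‖⌊gridPt x̃⌋_e‖ < √n/t` (`= d`);
* consequences for good points with `R = 2^{ℓR}` and `√n/t ≤ λ₁(L*)/2`: the query is admissible
  (`admissible_of_goodT`), the ideal answer is `tableZ bc (−mVec x̃)` (`answerTable_of_goodT`) and the
  recomposition returns `x̃` (`recover_of_goodT`) — the inputs of the `clean` register hypothesis.

Everything is proved; definitions have bodies; no named fact is introduced.

## References

* O. Regev, *On lattices, learning with errors, random linear codes, and cryptography*, J. ACM 56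
  (2009), art. 34; author's version arXiv:2401.03703: Lemma 3.14 (proof), p. 20 [Regev2009].
* D. Micciancio, S. Goldwasser, *Complexity of Lattice Problems*, Kluwer 2002, Ch. 1 §1.1
  [MicciancioGoldwasser2002].
-/

noncomputable section

namespace Literature.Computability.Cryptography

namespace Regev2009

namespace SamplerGeom

open Literature.Algebra.EuclideanLattices Literature.Algebra.EuclideanLattices.Regev2009
  Literature.Algebra.EuclideanLattices.Regev2009.QPart Peikert2009 Finset SamplerArith SamplerScale CVPOracle Module
open scoped InnerProductSpace

variable (I : LatticeInstance) [hZ : IsZLattice ℝ I.lattice] (R : ℕ) [NeZero R] (t : ℝ) (ht : t ≠ 0)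

/-! ### Branch, lattice part and coset index of a rescaled grid point -/

/-- **The branch of a grid point**: `y_t(t • gridPt x̃) = t • gridPt (ytil x̃)`. [cite: Regev2009, Lemma 3.14 (proof: "x mod P(L*)")] -/
theorem yOfB_bRT_gridPt (x : Fin I.n → ℤ) : yOfB (bRT I R t ht) (t • gridPt I R x) = t • gridPt I R (ytil I x) := by
  rw [yOfB_bRT_smul, fract_gridPt]

/-- **The lattice part of a grid point**: `t • gridPt x̃ − y_t = t • ⌊gridPt x̃⌋_e`. [folklore] -/
theorem smul_gridPt_sub_yOfB (x : Fin I.n → ℤ) :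
    t • gridPt I R x - yOfB (bRT I R t ht) (t • gridPt I R x) =
      t • (ZSpan.floor (eB I R) (gridPt I R x) : EuclideanSpace ℝ (Fin I.n)) := by
  rw [smul_sub_yOfB_bRT, gridPt_sub_fract]

/-- The lattice part lies in the fine lattice `LamT`. [folklore] -/
theorem smul_gridPt_sub_yOfB_mem (x : Fin I.n → ℤ) :
    t • gridPt I R x - yOfB (bRT I R t ht) (t • gridPt I R x) ∈ LamT I R t ht :=
  sub_yOfB_mem (bRT I R t ht) _

/-- The `ℤ`-coordinates of the lattice part in the basis `eT` are `aVec x̃`. [cite: Regev2009, Lemma 3.14 (proof)] -/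
theorem repr_eT_smul_gridPt_sub_yOfB (x : Fin I.n → ℤ) (i : Fin I.n) :
    (eT I R t ht).repr ⟨_, smul_gridPt_sub_yOfB_mem I R t ht x⟩ i = aVec I x i := by
  apply Int.cast_injective (α := ℝ)
  have h1 : (((eT I R t ht).repr ⟨_, smul_gridPt_sub_yOfB_mem I R t ht x⟩ i : ℤ) : ℝ) =
      (bRT I R t ht).repr (t • gridPt I R x - yOfB (bRT I R t ht) (t • gridPt I R x)) i :=
    Basis.restrictScalars_repr_apply ℤ (bRT I R t ht) _ i
  rw [h1, smul_gridPt_sub_yOfB,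
    show bRT I R t ht = (eB I R).unitsSMul fun _ => Units.mk0 t ht from dualOverBasis_scaledL_eq I t ht R,
    repr_unitsSMul_smul, ZSpan.repr_floor_apply, floor_repr_gridPt]

/-- **The coset index of a grid point is `aVec x̃ mod R`.** [cite: Regev2009, Lemma 3.14 (proof: "the natural mapping between `L*/R ∩ P(L*)` and `ℤ_Rⁿ`")] -/
theorem sOfB_T_gridPt (x : Fin I.n → ℤ) :
    sOfB (bRT I R t ht) (LamT I R t ht) (eT I R t ht) R (t • gridPt I R x) = fun i => ((aVec I x i : ℤ) : ZMod R) := by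
  funext i
  unfold sOfB
  rw [dif_pos (smul_gridPt_sub_yOfB_mem I R t ht x), repr_eT_smul_gridPt_sub_yOfB]

/-- **… and equals the residue word `sNat x̃`** (`sNat = aVec mod R` as naturals). [cite: Regev2009, Lemma 3.14 (proof)] -/
theorem sOfB_T_gridPt_eq_sNat (x : Fin I.n → ℤ) :
    sOfB (bRT I R t ht) (LamT I R t ht) (eT I R t ht) R (t • gridPt I R x) = fun i => ((sNat I R x i : ℕ) : ZMod R) := by
  rw [sOfB_T_gridPt]
  funext i
  rw [← sNat_add_mul_mVec (Nat.pos_of_ne_zero (NeZero.ne R)) x i]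
  push_cast
  rw [ZMod.natCast_self, zero_mul, add_zero]

/-! ### Good grid points -/

/-- **A grid point is good iff its lattice part is shorter than `√n/t`.** [cite: Regev2009, Lemma 3.14 (proof: "within distance `d` of `L*`")] -/
theorem goodT_gridPt_iff {t : ℝ} (ht : 0 < t) (x : Fin I.n → ℤ) :
    GoodT I R t ht.ne' (t • gridPt I R x) ↔
      ‖(ZSpan.floor (eB I R) (gridPt I R x) : EuclideanSpace ℝ (Fin I.n))‖ < Real.sqrt I.n / t := by
  rw [goodT_smul_iff I R ht, gridPt_sub_fract]

/-- **Good ⇒ admissible query** (`R = 2^{ℓR}`, `bc ≤ ℓR`, distance parameter `d = √n/t`). [cite: Regev2009, Lemma 3.14 (proof), Lemma 3.5] -/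
theorem admissible_of_goodT {t : ℝ} (ht : 0 < t) {ℓR bc : ℕ} (hbc : bc ≤ ℓR) (x : Fin I.n → ℤ)
    (hg : GoodT I (2 ^ ℓR) t ht.ne' (t • gridPt I (2 ^ ℓR) x)) :
    Admissible I (Real.sqrt I.n / t) (sNat I (2 ^ ℓR) x, ℓR, bc) :=
  admissible_sNat_of_norm_floor_le I hbc x ((goodT_gridPt_iff I (2 ^ ℓR) ht x).1 hg).le

/-- **Good ⇒ the ideal answer is `tableZ bc (−mVec x̃)`** (when `√n/t ≤ λ₁(L*)/2`). [cite: Regev2009, Lemma 3.14 (proof)] -/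
theorem answerTable_of_goodT {t : ℝ} (ht : 0 < t) (hd : Real.sqrt I.n / t ≤ minNorm (dualLattice I.lattice) / 2)
    (ℓR bc : ℕ) (x : Fin I.n → ℤ) (hg : GoodT I (2 ^ ℓR) t ht.ne' (t • gridPt I (2 ^ ℓR) x)) :
    answerTable I (sNat I (2 ^ ℓR) x, ℓR, bc) = tableZ bc (fun j => -mVec I (2 ^ ℓR) x j) :=
  answerTable_sNat I ℓR bc x (((goodT_gridPt_iff I (2 ^ ℓR) ht x).1 hg).trans_le hd)

/-- **Good ⇒ the recomposition from branch, residues and the ideal answer returns `x̃`** (when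
`√n/t ≤ λ₁(L*)/2`): the erasure of the point register is exact. [cite: Regev2009, Lemma 3.14 (proof: "using the CVP oracle, we can recover x")] -/
theorem recover_of_goodT {t : ℝ} (ht : 0 < t) (hd : Real.sqrt I.n / t ≤ minNorm (dualLattice I.lattice) / 2)
    (ℓR bc : ℕ) (x : Fin I.n → ℤ) (hg : GoodT I (2 ^ ℓR) t ht.ne' (t • gridPt I (2 ^ ℓR) x)) :
    recover I (2 ^ ℓR) (ytil I x) (sNat I (2 ^ ℓR) x) (coords I (point I (sNat I (2 ^ ℓR) x, ℓR, bc))) = x :=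
  recover_coords_eq I ℓR bc x (((goodT_gridPt_iff I (2 ^ ℓR) ht x).1 hg).trans_le hd)

end SamplerGeom

end Regev2009

end Literature.Computability.Cryptography

end
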